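import Summits.NavierStokesRegularity.NavierStokesRegularity.Theorems.RobustBlowupPortabilityDivFreeTruncationParametric
import Literature.Analysis.FluidPDE.SolenoidalTruncation
import Mathlib.Analysis.Calculus.BumpFunction.Normed
import Mathlib.Analysis.Calculus.BumpFunction.InnerProduct
import HarnessLib

/-!
# Concrete weights, cut-offs and elementary bounds for the divergence-free truncation
  (tools for item stmt-NavierStokesRegularity-2928, `RobustBlowupPortability.DivFreeTruncation`)

On `ℝ³ = EuclideanSpace ℝ (Fin 3)`, for a radius `ρ > 0`:

* `exists_weight` — a smooth weight `θ ≥ 0` supported in `‖a‖ < ρ/16` with `∫ θ = 1`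
  (a normed `ContDiffBump`);
* `exists_cutoff` — a smooth cut-off `χ`, `= 1` on `‖y‖ < 9ρ/8`, `= 0` on `‖y‖ ≥ 15ρ/8`;
* `contDiff_correctorKernel` — smoothness of the corrector kernel
  `K(x, a, t) = θ(a) t (Dχ(x − a)[x − a] id − Dχ(x − a) ⊗ (x − a))` in `(x, a, t)`;
* `norm_iteratedFDeriv_smul_le_of_bounds` — Leibniz bound for `c • V` on the shell;
* `setIntegral_norm_le` — `∫_{ball} ‖V‖ ≤ |ball| + ∫_{ball} ‖V‖²`;
* translation lemmas (`setIntegral_ball_comp_add`, `isDivFree_comp_add`).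

HONEST FRAMING: elementary calculus; nothing here bears on Navier–Stokes regularity.
-/

noncomputable section

set_option linter.dupNamespace false

namespace Summit.NavierStokesRegularity.NavierStokesRegularity.Theorems

open Set MeasureTheory Filter Topology Function ContinuousLinearMap Module Metric
open scoped ContDiff
open Literature.Analysis.FluidPDE

namespace DivFreeTruncation

/-- **A smooth averaging weight**: smooth, vanishing for `‖a‖ ≥ ρ/16`, total mass `1` on the closed
ball of radius `ρ/16` (normed bump function). [folklore] -/
theorem exists_weight {ρ : ℝ} (hρ : 0 < ρ) :
    ∃ θ : EuclideanSpace ℝ (Fin 3) → ℝ, ContDiff ℝ ∞ θ ∧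
      (∀ a : EuclideanSpace ℝ (Fin 3), ρ / 16 ≤ ‖a‖ → θ a = 0) ∧
      ∫ a in closedBall (0 : EuclideanSpace ℝ (Fin 3)) (ρ / 16), θ a = 1 := by
  let θb : ContDiffBump (0 : EuclideanSpace ℝ (Fin 3)) :=
    ⟨ρ / 32, ρ / 16, by positivity, by linarith⟩
  refine ⟨θb.normed volume, θb.contDiff_normed (n := ⊤), ?_, ?_⟩
  · intro a ha
    have : a ∉ Function.support (θb.normed volume) := by
      rw [θb.support_normed_eq]
      simp only [mem_ball_zero_iff, not_lt]
      exact ha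
    simpa [Function.mem_support] using this
  · have hzero : ∀ a, a ∉ closedBall (0 : EuclideanSpace ℝ (Fin 3)) (ρ / 16) →
        θb.normed volume a = 0 := by
      intro a ha
      have : a ∉ Function.support (θb.normed volume) := by
        rw [θb.support_normed_eq]
        exact fun h => ha (ball_subset_closedBall h)
      simpa [Function.mem_support] using this
    rw [setIntegral_eq_integral_of_forall_compl_eq_zero hzero]
    exact θb.integral_normed

/-- **A smooth cut-off with room**: `χ = 1` on `‖y‖ < 9ρ/8`, `χ = 0` on `‖y‖ ≥ 15ρ/8`. [folklore] -/
theorem exists_cutoff {ρ : ℝ} (hρ : 0 < ρ) :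
    ∃ χ : EuclideanSpace ℝ (Fin 3) → ℝ, ContDiff ℝ ∞ χ ∧
      (∀ y ∈ ball (0 : EuclideanSpace ℝ (Fin 3)) (9 * ρ / 8), χ y = 1) ∧
      ∀ y : EuclideanSpace ℝ (Fin 3), 15 * ρ / 8 ≤ ‖y‖ → χ y = 0 := by
  let χb : ContDiffBump (0 : EuclideanSpace ℝ (Fin 3)) :=
    ⟨9 * ρ / 8, 15 * ρ / 8, by positivity, by linarith⟩
  refine ⟨χb, χb.contDiff (n := ⊤), fun y hy => χb.one_of_mem_closedBall (ball_subset_closedBall hy),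
    fun y hy => χb.zero_of_le_dist ?_⟩
  simpa [dist_zero_right] using hy

/-- **Smoothness of the corrector kernel**
`K(x, a, t) = θ(a) t (Dχ(x − a)[x − a] id − Dχ(x − a) ⊗ (x − a))` in `(x, a, t)`. [folklore] -/
theorem contDiff_correctorKernel {θ χ : EuclideanSpace ℝ (Fin 3) → ℝ} (hθ : ContDiff ℝ ∞ θ)
    (hχ : ContDiff ℝ ∞ χ) :
    ContDiff ℝ ∞ fun q : EuclideanSpace ℝ (Fin 3) × (EuclideanSpace ℝ (Fin 3) × ℝ) =>
      (θ q.2.1 * q.2.2) • ((fderiv ℝ χ (q.1 - q.2.1) (q.1 - q.2.1)) •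
          ContinuousLinearMap.id ℝ (EuclideanSpace ℝ (Fin 3)) -
        (fderiv ℝ χ (q.1 - q.2.1)).smulRight (q.1 - q.2.1)) := by
  have hsub : ContDiff ℝ ∞ fun q : EuclideanSpace ℝ (Fin 3) × (EuclideanSpace ℝ (Fin 3) × ℝ) =>
      q.1 - q.2.1 := contDiff_fst.sub (contDiff_fst.comp contDiff_snd)
  have hDχ : ContDiff ℝ ∞ (fderiv ℝ χ) := hχ.fderiv_right (by exact_mod_cast le_top)
  have hDχ' : ContDiff ℝ ∞ fun q : EuclideanSpace ℝ (Fin 3) × (EuclideanSpace ℝ (Fin 3) × ℝ) =>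
      fderiv ℝ χ (q.1 - q.2.1) := hDχ.comp hsub
  have hθ' : ContDiff ℝ ∞ fun q : EuclideanSpace ℝ (Fin 3) × (EuclideanSpace ℝ (Fin 3) × ℝ) =>
      θ q.2.1 * q.2.2 :=
    (hθ.comp (contDiff_fst.comp contDiff_snd)).mul (contDiff_snd.comp contDiff_snd)
  exact hθ'.smul (((hDχ'.clm_apply hsub).smul contDiff_const).sub (hDχ'.smulRight hsub))

/-- **Leibniz bound for `c • V` on the shell**: if `‖Dⁱc(x)‖ ≤ N` for `i ≤ n` and
`‖DʲV‖ ≤ A j` on the shell containing `x`, then `‖Dⁿ(c V)(x)‖ ≤ 2ⁿ N Σ_{j≤n} |A j|`. [folklore] -/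
theorem norm_iteratedFDeriv_smul_le_of_bounds {c : EuclideanSpace ℝ (Fin 3) → ℝ}
    {V : EuclideanSpace ℝ (Fin 3) → EuclideanSpace ℝ (Fin 3)} (hc : ContDiff ℝ ∞ c)
    (hV : ContDiff ℝ ∞ V) {ρ : ℝ} {A : ℕ → ℝ}
    (hA : ∀ (j : ℕ) (y : EuclideanSpace ℝ (Fin 3)), ρ / 2 ≤ ‖y‖ → ‖y‖ ≤ 2 * ρ →
      ‖iteratedFDeriv ℝ j V y‖ ≤ A j)
    {n : ℕ} {N : ℝ} (hN0 : 0 ≤ N) {x : EuclideanSpace ℝ (Fin 3)}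
    (hN : ∀ i ∈ Finset.range (n + 1), ‖iteratedFDeriv ℝ i c x‖ ≤ N)
    (hx1 : ρ / 2 ≤ ‖x‖) (hx2 : ‖x‖ ≤ 2 * ρ) :
    ‖iteratedFDeriv ℝ n (fun y => c y • V y) x‖ ≤ 2 ^ n * N * ∑ j ∈ Finset.range (n + 1), |A j| := by
  have h := norm_iteratedFDeriv_smul_le hc hV x (n := n) (by exact_mod_cast le_top)
  refine h.trans ?_
  have hterm : ∀ i ∈ Finset.range (n + 1),
      (n.choose i : ℝ) * ‖iteratedFDeriv ℝ i c x‖ * ‖iteratedFDeriv ℝ (n - i) V x‖ ≤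
      (n.choose i : ℝ) * N * ∑ j ∈ Finset.range (n + 1), |A j| := by
    intro i hi
    have hgi : ‖iteratedFDeriv ℝ (n - i) V x‖ ≤ ∑ j ∈ Finset.range (n + 1), |A j| := by
      refine (hA (n - i) x hx1 hx2).trans ((le_abs_self _).trans ?_)
      exact Finset.single_le_sum (f := fun j => |A j|) (fun j _ => abs_nonneg (A j))
        (Finset.mem_range.2 (by omega))
    have hc0 : (0 : ℝ) ≤ (n.choose i : ℝ) := Nat.cast_nonneg _
    exact mul_le_mul (mul_le_mul_of_nonneg_left (hN i hi) hc0) hgi (norm_nonneg _)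
      (mul_nonneg hc0 hN0)
  refine (Finset.sum_le_sum hterm).trans (le_of_eq ?_)
  rw [← Finset.sum_mul, ← Finset.sum_mul]
  have hsum : ∑ i ∈ Finset.range (n + 1), (n.choose i : ℝ) = 2 ^ n := by
    rw [← Nat.cast_sum, Nat.sum_range_choose]; push_cast; ring
  rw [hsum]

/-- **Uniform derivative bounds for a smooth function on a compact set**, all orders up to `n` at
once. [folklore] -/
theorem exists_forall_norm_iteratedFDeriv_le_of_compact {F : Type*} [NormedAddCommGroup F]
    [NormedSpace ℝ F] {c : EuclideanSpace ℝ (Fin 3) → F} (hc : ContDiff ℝ ∞ c)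
    {S : Set (EuclideanSpace ℝ (Fin 3))} (hS : IsCompact S) (n : ℕ) :
    ∃ N : ℝ, 0 ≤ N ∧ ∀ i ∈ Finset.range (n + 1), ∀ x ∈ S, ‖iteratedFDeriv ℝ i c x‖ ≤ N := by
  have hb : ∀ i : ℕ, ∃ Ni : ℝ, 0 ≤ Ni ∧ ∀ x ∈ S, ‖iteratedFDeriv ℝ i c x‖ ≤ Ni := by
    intro i
    obtain ⟨C, hC⟩ := hS.exists_bound_of_continuousOn
      ((hc.continuous_iteratedFDeriv (m := i) (by exact_mod_cast le_top)).continuousOn)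
    exact ⟨max C 0, le_max_right _ _, fun x hx => (hC x hx).trans (le_max_left _ _)⟩
  choose Ni hNi0 hNi using hb
  refine ⟨∑ i ∈ Finset.range (n + 1), Ni i, Finset.sum_nonneg fun i _ => hNi0 i,
    fun i hi x hx => (hNi i x hx).trans ?_⟩
  exact Finset.single_le_sum (f := Ni) (fun j _ => hNi0 j) hi

/-- `‖v‖ ≤ 1 + ‖v‖²`. [folklore] -/
theorem norm_le_one_add_sq {F : Type*} [NormedAddCommGroup F] (v : F) : ‖v‖ ≤ 1 + ‖v‖ ^ 2 := by
  nlinarith [norm_nonneg v, sq_nonneg (‖v‖ - 1)]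

/-- **`L¹` from `L²` on a ball**: `∫_{ball 0 R} ‖V‖ ≤ |ball 0 R| + ∫_{ball 0 R} ‖V‖²` for
continuous `V`. [folklore] -/
theorem setIntegral_norm_le {V : EuclideanSpace ℝ (Fin 3) → EuclideanSpace ℝ (Fin 3)}
    (hV : Continuous V) (R : ℝ) :
    ∫ y in ball (0 : EuclideanSpace ℝ (Fin 3)) R, ‖V y‖ ≤
      (volume : Measure (EuclideanSpace ℝ (Fin 3))).real (ball (0 : EuclideanSpace ℝ (Fin 3)) R) +
        ∫ y in ball (0 : EuclideanSpace ℝ (Fin 3)) R, ‖V y‖ ^ 2 := by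
  have hK : IsCompact (closedBall (0 : EuclideanSpace ℝ (Fin 3)) R) := isCompact_closedBall _ _
  have hi1 : IntegrableOn (fun y => ‖V y‖) (ball (0 : EuclideanSpace ℝ (Fin 3)) R) volume :=
    (hV.norm.continuousOn.integrableOn_compact hK).mono_set ball_subset_closedBall
  have hi2 : IntegrableOn (fun y => ‖V y‖ ^ 2) (ball (0 : EuclideanSpace ℝ (Fin 3)) R) volume :=
    ((hV.norm.pow 2).continuousOn.integrableOn_compact hK).mono_set ball_subset_closedBall
  have hi3 : IntegrableOn (fun _ => (1 : ℝ)) (ball (0 : EuclideanSpace ℝ (Fin 3)) R) volume :=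
    integrableOn_const (measure_ball_lt_top.ne)
  calc ∫ y in ball (0 : EuclideanSpace ℝ (Fin 3)) R, ‖V y‖
      ≤ ∫ y in ball (0 : EuclideanSpace ℝ (Fin 3)) R, (1 + ‖V y‖ ^ 2) :=
        setIntegral_mono hi1 (hi3.add hi2) fun y => norm_le_one_add_sq (V y)
    _ = _ := by rw [integral_add hi3 hi2, setIntegral_const, smul_eq_mul, mul_one]

/-- **Translation of a set integral over a ball**:
`∫_{ball 0 R} f(y + x₀) dy = ∫_{ball x₀ R} f`. [folklore] -/
theorem setIntegral_ball_comp_add {F : Type*} [NormedAddCommGroup F] [NormedSpace ℝ F]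
    (f : EuclideanSpace ℝ (Fin 3) → F) (x₀ : EuclideanSpace ℝ (Fin 3)) (R : ℝ) :
    ∫ y in ball (0 : EuclideanSpace ℝ (Fin 3)) R, f (y + x₀) = ∫ y in ball x₀ R, f y := by
  rw [← integral_indicator measurableSet_ball, ← integral_indicator measurableSet_ball]
  have h : (ball (0 : EuclideanSpace ℝ (Fin 3)) R).indicator (fun y => f (y + x₀)) =
      fun y => (ball x₀ R).indicator f (y + x₀) := by
    funext y
    by_cases hy : y ∈ ball (0 : EuclideanSpace ℝ (Fin 3)) R
    · have hy' : y + x₀ ∈ ball x₀ R := by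
        rw [mem_ball, dist_eq_norm, add_sub_cancel_right]; exact mem_ball_zero_iff.1 hy
      rw [indicator_of_mem hy, indicator_of_mem hy']
    · have hy' : y + x₀ ∉ ball x₀ R := by
        rw [mem_ball, dist_eq_norm, add_sub_cancel_right]; exact fun h => hy (mem_ball_zero_iff.2 h)
      rw [indicator_of_notMem hy, indicator_of_notMem hy']
  rw [h]
  exact integral_add_right_eq_self (fun y => (ball x₀ R).indicator f y) x₀

/-- Divergence of a translate. [folklore] -/
theorem divergence_comp_add (V : EuclideanSpace ℝ (Fin 3) → EuclideanSpace ℝ (Fin 3))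
    (x₀ x : EuclideanSpace ℝ (Fin 3)) :
    VectorCalculus.divergence (fun z => V (z + x₀)) x = VectorCalculus.divergence V (x + x₀) := by
  rw [divergence_eq_traceCLM, divergence_eq_traceCLM, fderiv_comp_add_right]

/-- Divergence of a translate (subtraction). [folklore] -/
theorem divergence_comp_sub (V : EuclideanSpace ℝ (Fin 3) → EuclideanSpace ℝ (Fin 3))
    (x₀ x : EuclideanSpace ℝ (Fin 3)) :
    VectorCalculus.divergence (fun z => V (z - x₀)) x = VectorCalculus.divergence V (x - x₀) := by
  rw [divergence_eq_traceCLM, divergence_eq_traceCLM, fderiv_comp_sub]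

end DivFreeTruncation

end Summit.NavierStokesRegularity.NavierStokesRegularity.Theorems
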